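import Summits.QuantumFields.BalabanUV.T4Continuum.Support.B13StepTermCodingBudget
import Summits.QuantumFields.BalabanUV.T4Continuum.Support.B13StepTermSocket
import Summits.QuantumFields.BalabanUV.T4Continuum.Support.B13TermRep

/-!
# NE5 ∕ U3, crux O1, row O1-d1 follower (iii-e) — `B13StepTermCodingBudgetSum`: THE TERMWISE INPUTS OF THE OWNER's END E1-termwise
# OVER THE ANCHORED CODING OF RECORD, part B — `TermBudget (codeWeight A κ₂) (17·Bud·K₀(64,8))` (ONE (1.26)-type pinned shape sum in
# range, a `2⁴`-cube torus on the junk scales) and the ASSEMBLY `TermRep ∧ TermLineAnalytic ∧ TermBound ∧ TermBudget` for the CODED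
# family with a VOLUME-UNIFORM class constant (design v0.3 R9's consequence as a theorem; part 4b of the anchored-coding series)

Cell `pub-balaban`, unit `b2b-balaban-t4-ne5-formalise-leaf-02` (NE5 formalisation swarm, leaf prover 02 — holder lineage of row
O1-d1 of `t4/b2b-balaban-t4-ne5-p1/O1-CLAIM-TABLE-NE5-P1.md` v1.3; journal INTENT l.8957 + addendum; design `B13StepDesign.md` v0.3 RULING
R9 «anchored term labels»).  Summits-side NEW WORK under the LEAN PLACEMENT RULE (cell modelling + kernel-checked bookkeeping on the swarm's
objects of record; nothing of the manuscripts under audit is asserted — [II] = [Balaban1988RG2Cluster] and [Balaban1987RG1] are cited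
for KIND∕locus only).
HONEST FRAMING: rung (B)+1 bookkeeping for the FINITE-VOLUME T⁴ programme — NOT the continuum limit by itself, NOT infinite
volume, NOT a mass gap, NOT Clay; NE5 NOT PROVED; spine 0∕9.  HONEST DEPENDENCY (cell line, verbatim): continuum YM on T⁴ ⇐ BetaPertH
∧ nine spine estimates (0/9 proved); BetaPertH ⇐ (D1) ∧ (D4) ∧ CAP+tail; G-an2-4 gates asym, D1 and NE2/3/4.

WHY.  The owner's termwise END `T4InputCauchyRateTermwise.ne5_at_of_stepModel_termwise_scale_nat` consumes `TermRep` ∕ `TermLineAnalytic`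
∕ `TermBound κ a` ∕ `TermBudget a G` with `X`-BLIND weights `a k i`; over the ABSOLUTE labels the budget `Σ_i a k i ≤ G` is extensive in
the number of domains of the step volume (this row's finding, l.5621) — design v0.3 R9 rules that the labels of record are anchored codes.
Parts 1–3 built the coding `anchored R`; this file turns per-domain termwise data into the four binders FOR THE CODED FAMILY
`(anchored R).lift T`, with a class constant that does not see the volume.

WHAT IS PROVED (kernel-checked; imports part 3 BY NAME; `G := B13DomainGeometryTR.domainGeometry R`, `D := b13InnerData R`).
* §1–§4 (`termLineAnalytic_lift`, `termBound_lift`, `pinned`, `pinned_shape_sum_le`, `codeWeight`, `termBound_anchored`) are part 4a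
  `B13StepTermCodingBudget` (imported BY NAME).
* §5 `cubesPerDir_junk`, `sum_domAt_exp_le` (`Σ_{X ∈ 𝐃_k} e^{−κ₂ d X} ≤ N_k⁴·K₀`, extensive — used on junk scales only, where
  `N_k = 2`), `decodeAt_eq_equiv`, and **`termBudget_anchored`**: `TermBudget (codeWeight A κ₂) (17·Bud·K₀(64,8))` from per-domain budgets
  `Summable (A k X) ∧ Σ'_t A k X t ≤ Bud` on every `X ∈ 𝐃_k` (the swarm's `summable_actMajorant_b13`∕`tsum_actMajorant_le_b13` SHAPES) —
  `17 = 1 + 2⁴`: in range `Bud·K₀`, on junk scales `Bud·2⁴·K₀`.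
* §6 **`termwise_inputs_anchored`**: `TermRep ∧ TermLineAnalytic ∧ TermBound κ₁ (codeWeight A κ₂) ∧ TermBudget (codeWeight A κ₂)
  (17·Bud·K₀)` for `(anchored R).lift T` — literally the `hrep`∕`hline`∕`hbd`∕`hbud` binders of the owner's termwise END, with `G`
  VOLUME-UNIFORM.  (Applying that END on the model of record is the owner lineage's END custody ∕ a later follower; not done here.)
* §7 **`actMajorant_translate`** (leaf-04's socket majorant `actMajorant (labelsIndexing G D) (touchInc G) 𝒜` is translation invariant in
  range when the ACTIVITY majorant `𝒜` is — displayed KIND: Euclidean invariance) and **`termwise_inputs_anchored_of_act`** (the assembly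
  in the swarm's activity currency: per-domain budgets = verbatim `UrsellOfRecordFaces.summable_∕tsum_actMajorant_le_b13`, `Bud = Φ₀∕(1−36Φ₀)`).
DISPLAYED, asserted nowhere: the per-domain majorant `A` and its bound on `T`, its translation invariance in range, the per-domain
budgets, line analyticity of `T`.  NOT an estimate about Bałaban's (2.14) terms; no END face re-wired; 0∕12 skeleton leaves on Bałaban's
concrete objects unchanged; NE5 NOT PROVED.  0 sorry; axioms ⊆ {propext, Classical.choice, Quot.sound}.
-/

noncomputable section

namespace Summit.QuantumFields.BalabanUV.T4Continuum.B13StepTermCodingBudgetSum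

open scoped BigOperators
open Literature.MathematicalPhysics.QuantumFieldTheory.Balaban1983to89
open Literature.MathematicalPhysics.QuantumFieldTheory.Balaban1983to89.TreeLengthTorus (TPt TDom)
open Literature.MathematicalPhysics.QuantumFieldTheory.Balaban1983to89.T4OutputRate (Carriers)
open Literature.MathematicalPhysics.QuantumFieldTheory.Balaban1983to89.T4InputCauchyRateData (StepModel)
open Literature.MathematicalPhysics.QuantumFieldTheory.Balaban1983to89.T4InputCauchyRateTermwise (TermRep TermBound TermBudget
  TermLineAnalytic)
open Summit.QuantumFields.BalabanUV.T4Continuum.B13Carriers (TwoRuns)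
open Summit.QuantumFields.BalabanUV.T4Continuum.B13InnerData (Bnd b13InnerData)
open Summit.QuantumFields.BalabanUV.T4Continuum.B13StepTermLabels (InnerLabel PolyLabel TermIdx InnerData Coding termLabels
  mem_termLabels coeff)
open Summit.QuantumFields.BalabanUV.T4Continuum.B13DomainGeometryTR (domainGeometry footprint mk_mem_footprint_iff)
open Summit.QuantumFields.BalabanUV.T4Continuum.ClusterRepOfDomains (DomainGeometry)
open Summit.QuantumFields.BalabanUV.T4Continuum.B13StepTermShift
open Summit.QuantumFields.BalabanUV.T4Continuum.B13StepTermTranslate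
open Summit.QuantumFields.BalabanUV.T4Continuum.B13StepTermCoding
open Summit.QuantumFields.BalabanUV.T4Continuum.B13StepTermCodingBudget
open Summit.QuantumFields.BalabanUV.T4Continuum.B13StepTermSocket (labelsIndexing touchInc coeff_eq)
open Summit.QuantumFields.BalabanUV.T4Continuum.B13TermRep (actMajorant actMajorant_of_rel actMajorant_of_not_rel actMajorant_nonneg)

/-! ## §5 `TermBudget` for the weight on codes: ONE pinned shape sum in range, a bounded torus on the junk scales -/

section BudgetSum

variable {G : Type} [GaugeGroup G] {R : TwoRuns G}

open B13CarriersTranslation (Dom.anchor Dom.recentre)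

/-- [folklore] On the junk scales the tori are truncated to `2` cubes per direction (`B13Carriers.TwoRuns.cubesPerDir_eq`). -/
theorem cubesPerDir_junk {k : ℕ} (hk : ¬ k + R.m' ≤ R.F.m + R.K) : R.cubesPerDir k = 2 := by
  rw [R.cubesPerDir_eq, show R.F.m + R.K - (k + R.m') = 0 by omega, pow_zero, mul_one]

/-- [folklore] A (1.26)-type bound on the WHOLE catalogue `𝐃_k` (extensive in the number `N_k⁴` of cubes of `π_k` — used only on the
junk scales, where `N_k = 2`): `Σ_{X ∈ 𝐃_k} e^{−κ₂ d X} ≤ N_k⁴ · K₀(64,8)` for `κ₂ ≥ 64·log 162`. -/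
theorem sum_domAt_exp_le {k : ℕ} {κ₂ : ℝ} (hκ : 64 * Real.log 162 ≤ κ₂) :
    ∑ X ∈ R.domAt k, Real.exp (-(κ₂ * R.carriers.d X)) ≤ (R.cubesPerDir k : ℝ) ^ 4 * B12TreeDecay.K₀ (4 * 2 ^ 4) (2 * 4) := by
  classical
  set f : R.carriers.Dom → ℝ := fun X => Real.exp (-(κ₂ * R.carriers.d X)) with hf
  have hf0 : ∀ X, 0 ≤ f X := fun X => Real.exp_nonneg _
  -- each domain of `𝐃_k` contains at least one cube `⟨k, q⟩`
  have h1 : ∑ X ∈ R.domAt k, f X ≤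
      ∑ X ∈ R.domAt k, ∑ q ∈ (Finset.univ : Finset (TPt 4 (R.cubesPerDir k))) with (⟨k, q⟩ : B13DomainGeometryTR.SCube R) ∈ footprint X,
        f X := by
    refine Finset.sum_le_sum fun X hX => ?_
    rw [Finset.sum_const, nsmul_eq_mul]
    refine le_mul_of_one_le_left (hf0 X) ?_
    obtain ⟨j, Y⟩ := X
    have hj : j = k := R.mem_domAt.1 hX
    subst hj
    obtain ⟨q, hq⟩ := Y.2.1
    have : 1 ≤ (Finset.univ.filter fun q : TPt 4 (R.cubesPerDir j) =>
        (⟨j, q⟩ : B13DomainGeometryTR.SCube R) ∈ footprint (⟨j, Y⟩ : R.carriers.Dom)).card :=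
      Finset.card_pos.2 ⟨q, Finset.mem_filter.2 ⟨Finset.mem_univ _, mk_mem_footprint_iff.2 hq⟩⟩
    exact_mod_cast this
  -- exchange the sums and apply (1.26) at every cube
  rw [Finset.sum_comm' (t' := Finset.univ)
    (s' := fun q => (R.domAt k).filter fun X => (⟨k, q⟩ : B13DomainGeometryTR.SCube R) ∈ footprint X)
    (h := fun X q => by simp only [Finset.mem_filter, Finset.mem_univ, true_and]; tauto)] at h1
  refine h1.trans ?_
  have h2 : ∀ q : TPt 4 (R.cubesPerDir k),
      ∑ X ∈ (R.domAt k).filter (fun X => (⟨k, q⟩ : B13DomainGeometryTR.SCube R) ∈ footprint X), f X ≤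
        B12TreeDecay.K₀ (4 * 2 ^ 4) (2 * 4) := fun q =>
    le_trans (Finset.sum_le_sum fun S _ =>
      Real.exp_le_exp.2 (neg_le_neg (mul_le_mul_of_nonneg_right hκ (R.carriers.d_nonneg S))))
      (B13DomainGeometryTR.ineq126_level (R := R) k ⟨k, q⟩)
  refine (Finset.sum_le_sum fun q _ => h2 q).trans ?_
  rw [Finset.sum_const, nsmul_eq_mul, Finset.card_univ]
  refine le_of_eq ?_
  congr 1
  rw [Fintype.card_pi, Finset.prod_const, Finset.card_univ, Fintype.card_fin, ZMod.card]
  push_cast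
  ring

end BudgetSum

section TermBudget

variable {G : Type} [GaugeGroup G] {R : TwoRuns G}

open B13CarriersTranslation (Dom.anchor Dom.recentre)

/-- [folklore] Decoding relative to `X` is a permutation of the labels (for `Equiv.tsum_eq`). -/
theorem decodeAt_eq_equiv (X : R.carriers.Dom) :
    (decodeAt X : TermIdx R.carriers.Dom (Bnd R) → TermIdx R.carriers.Dom (Bnd R)) = TermIdx.translateEquiv X.1 (Dom.anchor X) :=
  rfl

/-- [folklore] **`TermBudget` FOR THE WEIGHT ON CODES, VOLUME-UNIFORM**: from per-domain budgets `Σ'_t A k X t ≤ Bud` on every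
`X ∈ 𝐃_k` (levelwise summable — the swarm's `summable_actMajorant_b13` ∕ `tsum_actMajorant_le_b13` shapes) and `κ₂ ≥ 64·log 162`,
`TermBudget (codeWeight A κ₂) (17 · Bud · K₀(64,8))`: in the meaningful range the weight sums to `Bud × (the pinned shape sum) ≤ Bud·K₀`
(ONE (1.26)-type shape sum — design v0.3 R9), on the junk scales to `Bud × Σ_{𝐃_k} e^{−κ₂ d} ≤ Bud·2⁴·K₀` (tori of `2⁴` cubes);
`17 = 1 + 2⁴` covers both.  The constant sees neither `X` nor the number of domains of the step volume. -/
theorem termBudget_anchored {A : ℕ → R.carriers.Dom → TermIdx R.carriers.Dom (Bnd R) → ℝ} {κ₂ Bud : ℝ}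
    (hBud : 0 ≤ Bud) (hκ : 64 * Real.log 162 ≤ κ₂)
    (hB : ∀ k, ∀ X ∈ R.domAt k, Summable (A k X) ∧ ∑' t, A k X t ≤ Bud) :
    TermBudget (codeWeight A κ₂) (17 * Bud * B12TreeDecay.K₀ (4 * 2 ^ 4) (2 * 4)) := by
  have hK₀ : 0 ≤ B12TreeDecay.K₀ (4 * 2 ^ 4) (2 * 4) := (B12TreeDecay.K₀_pos _ _).le
  intro k
  by_cases hk : k + R.m' ≤ R.F.m + R.K
  · -- in range: the pinned shape sum
    have hfun : codeWeight A κ₂ k = fun i => ∑ S ∈ pinned R k, A k S i * Real.exp (-(κ₂ * R.carriers.d S)) := by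
      funext i; rw [codeWeight, if_pos hk]
    have hsum : ∀ S ∈ pinned R k, Summable fun i => A k S i * Real.exp (-(κ₂ * R.carriers.d S)) :=
      fun S hS => ((hB k S (mem_pinned.1 hS).1).1).mul_right _
    refine ⟨by rw [hfun]; exact summable_sum hsum, ?_⟩
    rw [hfun, Summable.tsum_finsetSum hsum]
    calc ∑ S ∈ pinned R k, ∑' i, A k S i * Real.exp (-(κ₂ * R.carriers.d S))
        = ∑ S ∈ pinned R k, (∑' i, A k S i) * Real.exp (-(κ₂ * R.carriers.d S)) :=
          Finset.sum_congr rfl fun S _ => tsum_mul_right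
      _ ≤ ∑ S ∈ pinned R k, Bud * Real.exp (-(κ₂ * R.carriers.d S)) :=
          Finset.sum_le_sum fun S hS => mul_le_mul_of_nonneg_right (hB k S (mem_pinned.1 hS).1).2 (Real.exp_nonneg _)
      _ = Bud * ∑ S ∈ pinned R k, Real.exp (-(κ₂ * R.carriers.d S)) := by rw [Finset.mul_sum]
      _ ≤ Bud * B12TreeDecay.K₀ (4 * 2 ^ 4) (2 * 4) := mul_le_mul_of_nonneg_left (pinned_shape_sum_le hκ) hBud
      _ ≤ 17 * Bud * B12TreeDecay.K₀ (4 * 2 ^ 4) (2 * 4) := by nlinarith [mul_nonneg hBud hK₀]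
  · -- junk scales: the whole (tiny) catalogue
    have hfun : codeWeight A κ₂ k = fun i => ∑ X ∈ R.domAt k, A k X (decodeAt X i) * Real.exp (-(κ₂ * R.carriers.d X)) := by
      funext i; rw [codeWeight, if_neg hk]
    have hsumX : ∀ X ∈ R.domAt k, Summable fun i => A k X (decodeAt X i) := fun X hX => by
      rw [decodeAt_eq_equiv]
      exact (Equiv.summable_iff _).2 (hB k X hX).1
    have hsum : ∀ X ∈ R.domAt k, Summable fun i => A k X (decodeAt X i) * Real.exp (-(κ₂ * R.carriers.d X)) :=
      fun X hX => (hsumX X hX).mul_right _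
    refine ⟨by rw [hfun]; exact summable_sum hsum, ?_⟩
    rw [hfun, Summable.tsum_finsetSum hsum]
    have hN : (R.cubesPerDir k : ℝ) ^ 4 = 16 := by rw [cubesPerDir_junk hk]; norm_num
    calc ∑ X ∈ R.domAt k, ∑' i, A k X (decodeAt X i) * Real.exp (-(κ₂ * R.carriers.d X))
        = ∑ X ∈ R.domAt k, (∑' i, A k X (decodeAt X i)) * Real.exp (-(κ₂ * R.carriers.d X)) :=
          Finset.sum_congr rfl fun X _ => tsum_mul_right
      _ = ∑ X ∈ R.domAt k, (∑' t, A k X t) * Real.exp (-(κ₂ * R.carriers.d X)) :=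
          Finset.sum_congr rfl fun X _ => by rw [decodeAt_eq_equiv, Equiv.tsum_eq]
      _ ≤ ∑ X ∈ R.domAt k, Bud * Real.exp (-(κ₂ * R.carriers.d X)) :=
          Finset.sum_le_sum fun X hX => mul_le_mul_of_nonneg_right (hB k X hX).2 (Real.exp_nonneg _)
      _ = Bud * ∑ X ∈ R.domAt k, Real.exp (-(κ₂ * R.carriers.d X)) := by rw [Finset.mul_sum]
      _ ≤ Bud * ((R.cubesPerDir k : ℝ) ^ 4 * B12TreeDecay.K₀ (4 * 2 ^ 4) (2 * 4)) :=
          mul_le_mul_of_nonneg_left (sum_domAt_exp_le hκ) hBud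
      _ ≤ 17 * Bud * B12TreeDecay.K₀ (4 * 2 ^ 4) (2 * 4) := by rw [hN]; nlinarith [mul_nonneg hBud hK₀]

end TermBudget

/-! ## §6 Assembly: the four termwise inputs of E1-termwise for the coded family, with a volume-uniform class constant -/

section Assembly

variable {G : Type} [GaugeGroup G] {R : TwoRuns G}
variable {Op Hist : Type*} [NormedAddCommGroup Op] [NormedSpace ℂ Op] [NormedAddCommGroup Hist] [NormedSpace ℂ Hist]

/-- [folklore] **THE TERMWISE INPUTS OF THE OWNER's END OVER THE ANCHORED CODING, VOLUME-UNIFORM** (design v0.3 R9 as a theorem):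
for a step model `M` on the carriers of record and a term family `T` over the ABSOLUTE labels of record with `TermRep` on a class
`K` and vanishing off the localizing labels, `TermLineAnalytic`, a nonnegative per-domain termwise majorant `A` at rate `κ₁ + κ₂`
(`κ₂ ≥ 64·log 162`) that is TRANSLATION INVARIANT IN THE MEANINGFUL RANGE, and per-domain budgets `Σ'_t A k X t ≤ Bud` on every
`X ∈ 𝐃_k` — the CODED family `(anchored R).lift T` satisfies `TermRep ∧ TermLineAnalytic ∧ TermBound κ₁ (codeWeight A κ₂) ∧
TermBudget (codeWeight A κ₂) (17·Bud·K₀(64,8))`: exactly the binders `hrep`∕`hline`∕`hbd`∕`hbud` of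
`T4InputCauchyRateTermwise.ne5_at_of_stepModel_termwise_scale_nat`, with a class constant `G = 17·Bud·K₀` that does NOT grow with
the number of domains of the step volume (absolute labels: `G ∝ #𝐃_k`).  All analytic content stays DISPLAYED (the majorant, its
invariance, the budgets, line analyticity); nothing of [II] is asserted. -/
theorem termwise_inputs_anchored (M : StepModel R.carriers Op Hist) (K : ℕ → (ℕ → ℝ) → R.carriers.BgB → Set (Op × Hist))
    (T : ℕ → TermIdx R.carriers.Dom (Bnd R) → Op → Hist → R.carriers.Dom → ℂ)
    {A : ℕ → R.carriers.Dom → TermIdx R.carriers.Dom (Bnd R) → ℝ} {W : Set (ℕ → ℝ)} {κ₁ κ₂ Bud : ℝ}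
    (hsupp : ∀ k (X : R.carriers.Dom) (o : Op) (h : Hist) (t : TermIdx R.carriers.Dom (Bnd R)),
      ¬ t.LocalizesAt (domainGeometry R) (b13InnerData R) k X → T k t o h X = 0)
    (hrep : TermRep M K T W) (hline : TermLineAnalytic K T W)
    (hA : ∀ k X t, 0 ≤ A k X t)
    (hAinv : ∀ k, k + R.m' ≤ R.F.m + R.K → ∀ (Y : TDom 4 (R.cubesPerDir k)) (v : TPt 4 (R.cubesPerDir k))
      (t : TermIdx R.carriers.Dom (Bnd R)), A k (translateAt k v ⟨k, Y⟩) (TermIdx.translate k v t) = A k ⟨k, Y⟩ t)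
    (hbd : ∀ k, ∀ g ∈ W, ∀ (U : R.carriers.BgB) (q : Op × Hist), q ∈ K k g U → ∀ X : R.carriers.Dom, R.carriers.scale X = k →
      ∀ t : TermIdx R.carriers.Dom (Bnd R), t.LocalizesAt (domainGeometry R) (b13InnerData R) k X →
        ‖T k t q.1 q.2 X‖ ≤ A k X t * Real.exp (-((κ₁ + κ₂) * R.carriers.d X)))
    (hBud : 0 ≤ Bud) (hκ : 64 * Real.log 162 ≤ κ₂)
    (hB : ∀ k, ∀ X ∈ R.domAt k, Summable (A k X) ∧ ∑' t, A k X t ≤ Bud) :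
    TermRep M K ((anchored R).lift T) W ∧ TermLineAnalytic K ((anchored R).lift T) W ∧
      TermBound K ((anchored R).lift T) W κ₁ (codeWeight A κ₂) ∧
      TermBudget (codeWeight A κ₂) (17 * Bud * B12TreeDecay.K₀ (4 * 2 ^ 4) (2 * 4)) :=
  ⟨termRep_anchored M K T hsupp hrep, termLineAnalytic_lift (anchored R) K T hline, termBound_anchored K T hA hAinv hbd,
    termBudget_anchored hBud hκ hB⟩

end Assembly

/-! ## §7 Bridge to the swarm's activity-majorant currency: `A := actMajorant 𝒜` is translation invariant when `𝒜` is -/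

section ActMajorant

variable {G : Type} [GaugeGroup G] {R : TwoRuns G}
variable {Op Hist : Type*} [NormedAddCommGroup Op] [NormedSpace ℂ Op] [NormedAddCommGroup Hist] [NormedSpace ℂ Hist]

/-- [folklore] **THE COMBINATORIAL MAJORANT OF THE SOCKET IS TRANSLATION INVARIANT IN RANGE WHEN THE ACTIVITY MAJORANT IS**: for
`𝒜 (translateAt k v Z) (ℓ.translate k v) = 𝒜 Z ℓ` (displayed; printed KIND: Euclidean invariance of the step, [Balaban1987RG1] p. 263),
leaf-04's `B13TermRep.actMajorant (labelsIndexing G D) (touchInc G) 𝒜` on the socket of record is invariant under the simultaneous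
translation of the domain and the label — the localization indicator by `localizesAt_translate_iff`, the coefficient by
`coeff_translate`, the activity product factorwise. -/
theorem actMajorant_translate {k : ℕ} (hk : k + R.m' ≤ R.F.m + R.K) (𝒜 : R.carriers.Dom → InnerLabel R.carriers.Dom (Bnd R) → ℝ)
    (h𝒜 : ∀ (v : TPt 4 (R.cubesPerDir k)) (Z : R.carriers.Dom) (ℓ : InnerLabel R.carriers.Dom (Bnd R)),
      𝒜 (translateAt k v Z) (InnerLabel.translate k v ℓ) = 𝒜 Z ℓ)
    (v : TPt 4 (R.cubesPerDir k)) (X : R.carriers.Dom) (t : TermIdx R.carriers.Dom (Bnd R)) :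
    actMajorant (labelsIndexing (domainGeometry R) (b13InnerData R)) (touchInc (domainGeometry R)) 𝒜 k (translateAt k v X)
        (TermIdx.translate k v t) =
      actMajorant (labelsIndexing (domainGeometry R) (b13InnerData R)) (touchInc (domainGeometry R)) 𝒜 k X t := by
  by_cases hrel : (labelsIndexing (domainGeometry R) (b13InnerData R)).Rel k t X
  · have hrel' : (labelsIndexing (domainGeometry R) (b13InnerData R)).Rel k (TermIdx.translate k v t) (translateAt k v X) :=
      ⟨hrel.1, (localizesAt_translate_iff hk v X t).2 hrel.2⟩
    rw [actMajorant_of_rel hrel, actMajorant_of_rel hrel', coeff_eq, coeff_eq, coeff_translate]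
    congr 1
    exact Finset.prod_congr rfl fun m _ => h𝒜 v _ _
  · have hrel' : ¬ (labelsIndexing (domainGeometry R) (b13InnerData R)).Rel k (TermIdx.translate k v t) (translateAt k v X) :=
      fun h => hrel ⟨h.1, (localizesAt_translate_iff hk v X t).1 h.2⟩
    rw [actMajorant_of_not_rel hrel, actMajorant_of_not_rel hrel']

/-- [folklore] **THE TERMWISE INPUTS OVER THE ANCHORED CODING IN THE SWARM's ACTIVITY CURRENCY**: `termwise_inputs_anchored` with
`A k X t := actMajorant … 𝒜 k X t` (the (2.38)+(2.27)-KIND per-term majorant of rows O1-d2∕d3, at rate `κ₁ + κ₂`), the invariance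
hypothesis read on the ACTIVITY majorant `𝒜` in range, and the per-domain budgets `Summable (actMajorant … k X) ∧ Σ' ≤ Bud` — verbatim
the conclusions of leaf-02's `UrsellOfRecordFaces.summable_actMajorant_b13`∕`tsum_actMajorant_le_b13` (Bud = Φ₀∕(1−36Φ₀)) or leaf-01's
`B13StepOfRecordActNorm.actBudget_record_of_actNormDecay`; conclusion: the four termwise binders for the coded family with
`G = 17·Bud·K₀(64,8)`, VOLUME-UNIFORM. -/
theorem termwise_inputs_anchored_of_act (M : StepModel R.carriers Op Hist) (K : ℕ → (ℕ → ℝ) → R.carriers.BgB → Set (Op × Hist))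
    (T : ℕ → TermIdx R.carriers.Dom (Bnd R) → Op → Hist → R.carriers.Dom → ℂ)
    (𝒜 : R.carriers.Dom → InnerLabel R.carriers.Dom (Bnd R) → ℝ) {W : Set (ℕ → ℝ)} {κ₁ κ₂ Bud : ℝ}
    (hsupp : ∀ k (X : R.carriers.Dom) (o : Op) (h : Hist) (t : TermIdx R.carriers.Dom (Bnd R)),
      ¬ t.LocalizesAt (domainGeometry R) (b13InnerData R) k X → T k t o h X = 0)
    (hrep : TermRep M K T W) (hline : TermLineAnalytic K T W) (h𝒜0 : ∀ Z ℓ, 0 ≤ 𝒜 Z ℓ)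
    (h𝒜inv : ∀ k, k + R.m' ≤ R.F.m + R.K → ∀ (v : TPt 4 (R.cubesPerDir k)) (Z : R.carriers.Dom)
      (ℓ : InnerLabel R.carriers.Dom (Bnd R)), 𝒜 (translateAt k v Z) (InnerLabel.translate k v ℓ) = 𝒜 Z ℓ)
    (hbd : ∀ k, ∀ g ∈ W, ∀ (U : R.carriers.BgB) (q : Op × Hist), q ∈ K k g U → ∀ X : R.carriers.Dom, R.carriers.scale X = k →
      ∀ t : TermIdx R.carriers.Dom (Bnd R), t.LocalizesAt (domainGeometry R) (b13InnerData R) k X →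
        ‖T k t q.1 q.2 X‖ ≤ actMajorant (labelsIndexing (domainGeometry R) (b13InnerData R)) (touchInc (domainGeometry R)) 𝒜 k X t *
          Real.exp (-((κ₁ + κ₂) * R.carriers.d X)))
    (hBud : 0 ≤ Bud) (hκ : 64 * Real.log 162 ≤ κ₂)
    (hB : ∀ k, ∀ X ∈ R.domAt k,
      Summable (actMajorant (labelsIndexing (domainGeometry R) (b13InnerData R)) (touchInc (domainGeometry R)) 𝒜 k X) ∧
        ∑' t, actMajorant (labelsIndexing (domainGeometry R) (b13InnerData R)) (touchInc (domainGeometry R)) 𝒜 k X t ≤ Bud) :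
    TermRep M K ((anchored R).lift T) W ∧ TermLineAnalytic K ((anchored R).lift T) W ∧
      TermBound K ((anchored R).lift T) W κ₁
        (codeWeight (fun k X t => actMajorant (labelsIndexing (domainGeometry R) (b13InnerData R)) (touchInc (domainGeometry R)) 𝒜 k X t)
          κ₂) ∧
      TermBudget (codeWeight (fun k X t => actMajorant (labelsIndexing (domainGeometry R) (b13InnerData R))
        (touchInc (domainGeometry R)) 𝒜 k X t) κ₂) (17 * Bud * B12TreeDecay.K₀ (4 * 2 ^ 4) (2 * 4)) :=
  termwise_inputs_anchored M K T hsupp hrep hline (fun k X t => actMajorant_nonneg h𝒜0 k X t)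
    (fun k hk Y v t => actMajorant_translate hk 𝒜 (h𝒜inv k hk) v ⟨k, Y⟩ t) hbd hBud hκ hB

end ActMajorant

end Summit.QuantumFields.BalabanUV.T4Continuum.B13StepTermCodingBudgetSum

end
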